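import Literature.NumberTheory.Transcendental.KZLogCalculusProofs
import Literature.NumberTheory.Transcendental.KZCalculusProofs
import Literature.NumberTheory.Transcendental.KZSemialgebraicComplex
import Literature.NumberTheory.Transcendental.SemialgebraicMapsProofs
import Mathlib.Analysis.Calculus.Deriv.Polynomial
import Mathlib.Analysis.SpecialFunctions.Sqrt

/-!
# `RealEllipticSectorKernel` (stmt-KontsevichZagierPeriods-10632, route HermiteRigidity) — line
`oval-hermite-engine`, stub `stub_exactForm`

The one analytic move of the line: over a real oval `(u, v)` of a rational polynomial `g`
(`g(u) = g(v) = 0`, `g > 0` on `(u, v)`), for every `Q ∈ ℚ[X]` the Hermite exact form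
`d(Q√g) = (Q′g + Qg′/2) dx/√g` integrates to a relation of the Kontsevich–Zagier calculus:
every representation `r = [(u,v), (Q′g + Qg′/2)/√g]` has `[r] ∈ KZ.relations`.

Derivation inside the calculus (no evaluation of integrals is used):
* ONE Newton–Leibniz move (`KZ.newtonLeibnizRel`, printed rule 3) with base `ℝ⁰`, constant bounds
  `a = u ≤ b = v` (real algebraic, hence `ℚ`-semialgebraic constants), CLOSED band
  `[u, v] = r.domain ∪ {u, v} ⊆ ℝ¹` carrying the integrand `𝟙_{r.domain} · r.integrand`
  (semialgebraic by gluing the graph over `r.domain` with the zero graph over the two endpoints,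
  integrable because `r.integrand` is integrable on `r.domain`), and primitive `F = Q√g`:
  `ℚ`-semialgebraic on the band, continuous on `[u, v]`, with derivative the integrand on `(u, v)`
  (`g > 0` there) and `F(v) − F(u) = 0 − 0 = 0`, which is the (zero) integrand of the base;
* the base `[ℝ⁰, 0]` is a relation (zero integrand), so the band representation is a relation;
* ONE domain-additivity move (rule 1a): band `=` `r.domain ∪ {u, v}`, the two endpoints being
  Lebesgue-null, so `[band] − [r] − [ends]` and `[ends]` are relations; hence `[r]` is.
[Kontsevich–Zagier 2001, §1.2, rules (1), (3)]
-/

noncomputable section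

open MeasureTheory Set Polynomial

namespace Summit.KontsevichZagierPeriods.HermiteRigidity.RealEllipticSectorKernel

open Literature.NumberTheory.Transcendental Literature.ModelTheory.ExponentialFields

/-- A one-variable rational polynomial evaluated at one coordinate, `z ↦ P(z i)`, is a
`ℚ`-semialgebraic function on every `ℚ`-semialgebraic `s ⊆ ℝⁿ` (it is the `MvPolynomial`
`P(Xᵢ)`). [folklore] -/
theorem exactForm_isSemialgebraicFunOn_aeval_apply {n : ℕ} {s : Set (Fin n → ℝ)}
    (hs : IsSemialgebraic ℚ s) (P : ℚ[X]) (i : Fin n) :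
    IsSemialgebraicFunOn ℚ s (fun z => aeval (z i) P) :=
  (isSemialgebraicFunOn_aeval hs (aeval (MvPolynomial.X i : MvPolynomial (Fin n) ℚ) P)).congr
    fun z _ => by
      simp only
      rw [← Polynomial.aeval_algHom_apply, MvPolynomial.aeval_X]

/-- The derivative of the Hermite primitive `Q√g` where `g > 0`:
`(Q√g)′ = (Q′g + Qg′/2)/√g`. [folklore] -/
theorem exactForm_hasDerivAt_mul_sqrt (g Q : ℚ[X]) {t : ℝ} (ht : 0 < aeval t g) :
    HasDerivAt (fun s : ℝ => aeval s Q * Real.sqrt (aeval s g))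
      ((aeval t (derivative Q) * aeval t g + aeval t Q * aeval t (derivative g) / 2) /
        Real.sqrt (aeval t g)) t := by
  have h1 := (Q.hasDerivAt_aeval t).fun_mul ((g.hasDerivAt_aeval t).sqrt ht.ne')
  refine h1.congr_deriv ?_
  have hs : 0 < Real.sqrt (aeval t g) := Real.sqrt_pos.mpr ht
  rw [eq_div_iff hs.ne', add_mul, mul_assoc, Real.mul_self_sqrt ht.le]
  field_simp

/-- **Stub `stub_exactForm`** (registered stub of crux stmt-KontsevichZagierPeriods-10632, line
`oval-hermite-engine`). ONE Hermite step over a real oval `(u, v)` of a rational polynomial `g`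
(`g(u) = g(v) = 0`, `g > 0` inside): the exact form `d(Q√g) = (Q′g + Qg′/2) dx/√g` integrates to
a relation — rule 3 with base `ℝ⁰`, band `[u, v]`, primitive `Q√g` (`ℚ`-semialgebraic, continuous
on `[u,v]`, vanishing at both ends, derivative the integrand inside), then rule 1a to drop the two
null endpoints, and the value-`0` base constant. [Kontsevich–Zagier 2001, §1.2, rules (1), (3)]
[folklore] -/
theorem stub_exactForm (g Q : ℚ[X]) (u v : ℝ) (huv : u < v)
    (hu : aeval u g = 0) (hv : aeval v g = 0) (hpos : ∀ x ∈ Ioo u v, 0 < aeval x g)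
    (r : KZ.IntegralRep 1) (hr : r.domain = {p | u < p 0 ∧ p 0 < v})
    (hri : EqOn r.integrand (fun p => (aeval (p 0) (derivative Q) * aeval (p 0) g
        + aeval (p 0) Q * aeval (p 0) (derivative g) / 2) / Real.sqrt (aeval (p 0) g)) r.domain) :
    KZ.of r ∈ KZ.relations := by
  -- the endpoints are real algebraic (`g ≠ 0` since `g > 0` on the non-empty oval)
  have hg0 : g ≠ 0 := by
    intro h
    have := hpos ((u + v) / 2) ⟨by linarith, by linarith⟩
    simp [h] at this
  have hua : IsAlgebraic ℚ u := ⟨g, hg0, hu⟩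
  have hva : IsAlgebraic ℚ v := ⟨g, hg0, hv⟩
  have hsnoc : ∀ (x : Fin 0 → ℝ) (t : ℝ), (Fin.snoc x t : Fin 1 → ℝ) 0 = t := fun _ _ => rfl
  -- the two endpoints `E = {u, v} ⊆ ℝ¹`: semialgebraic, null, disjoint from `r.domain`
  obtain ⟨E, hEdef⟩ : ∃ E : Set (Fin 1 → ℝ), E = {z | z 0 = u ∨ z 0 = v} := ⟨_, rfl⟩
  have hE : IsSemialgebraic ℚ E := by
    rw [hEdef]
    exact (isSemialgebraic_setOf_apply_eq_of_isAlgebraic hua 0).union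
      (isSemialgebraic_setOf_apply_eq_of_isAlgebraic hva 0)
  have hEvol : volume E = 0 := by
    have : E = {fun _ => u, fun _ => v} := by
      rw [hEdef]; ext z; simp [funext_iff, Fin.forall_fin_one]
    rw [this]
    exact (Set.toFinite _).measure_zero _
  have hEr : ∀ z ∈ E, z ∉ r.domain := by
    intro z hz hzr
    rw [hEdef] at hz
    rw [hr, mem_setOf_eq] at hzr
    rcases hz with h | h <;> rw [h] at hzr <;> linarith [hzr.1, hzr.2]
  -- the closed band `[u, v] = r.domain ∪ E` with the integrand `𝟙_{r.domain} r.integrand`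
  have hB : IsSemialgebraic ℚ (r.domain ∪ E) := r.isSemialgebraic_domain.union hE
  have hBfun : IsSemialgebraicFunOn ℚ (r.domain ∪ E) (indicator r.domain r.integrand) :=
    IsSemialgebraicFunOn.union r.isSemialgebraicFunOn_integrand
      ((isSemialgebraicFunOn_aeval hE (0 : MvPolynomial (Fin 1) ℚ)).congr fun z hz => by
        simp [indicator_of_notMem (hEr z hz)])
      (fun z hz => indicator_of_mem hz _) (fun _ _ => rfl)
  have hBint : IntegrableOn (indicator r.domain r.integrand) (r.domain ∪ E) :=
    ((integrable_indicator_iff (KZ.IntegralRep.measurableSet_domain_holds r)).mpr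
      r.integrableOn).integrableOn
  obtain ⟨rb, hrbd, hrbi⟩ : ∃ rb : KZ.IntegralRep 1, rb.domain = r.domain ∪ E ∧
      rb.integrand = indicator r.domain r.integrand :=
    ⟨⟨r.domain ∪ E, indicator r.domain r.integrand, hB, hBfun, hBint⟩, rfl, rfl⟩
  -- the base `[ℝ⁰, 0]`
  obtain ⟨r₀, hr₀d, hr₀i⟩ := KZ.exists_zeroRep (n := 0) (σ := univ) isSemialgebraic_univ
  -- the primitive `F = Q√g` is semialgebraic on the band
  have hF : IsSemialgebraicFunOn ℚ (r.domain ∪ E)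
      (fun z => aeval (z 0) Q * Real.sqrt (aeval (z 0) g)) :=
    IsSemialgebraicFunOn.mul_holds (exactForm_isSemialgebraicFunOn_aeval_apply hB Q 0)
      (IsSemialgebraicFunOn.sqrt_holds (exactForm_isSemialgebraicFunOn_aeval_apply hB g 0))
  -- ONE Newton–Leibniz move
  have hNL : KZ.of rb - KZ.of r₀ ∈ KZ.newtonLeibnizRel := by
    refine ⟨0, rb, r₀, fun _ => u, fun _ => v, fun z => aeval (z 0) Q * Real.sqrt (aeval (z 0) g),
      hrbd ▸ hF, ?_, ?_, fun _ _ => huv.le, ?_, ?_, ?_, ?_, rfl⟩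
    · rw [hr₀d]; exact isSemialgebraicFunOn_const_of_isAlgebraic isSemialgebraic_univ hua
    · rw [hr₀d]; exact isSemialgebraicFunOn_const_of_isAlgebraic isSemialgebraic_univ hva
    · rw [hrbd, hr₀d, hEdef, hr]
      ext z
      simp only [mem_union, mem_setOf_eq, mem_univ, true_and, Fin.last_zero]
      constructor
      · rintro (⟨h1, h2⟩ | h | h)
        · exact ⟨h1.le, h2.le⟩
        · rw [h]; exact ⟨le_rfl, huv.le⟩
        · rw [h]; exact ⟨huv.le, le_rfl⟩
      · rintro ⟨h1, h2⟩
        rcases h1.lt_or_eq with h1 | h1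
        · rcases h2.lt_or_eq with h2 | h2
          · exact Or.inl ⟨h1, h2⟩
          · exact Or.inr (Or.inr h2)
        · exact Or.inr (Or.inl h1.symm)
    · intro x _
      show ContinuousOn (fun t : ℝ => aeval ((Fin.snoc x t : Fin 1 → ℝ) 0) Q *
        Real.sqrt (aeval ((Fin.snoc x t : Fin 1 → ℝ) 0) g)) _
      simp only [hsnoc]
      exact ((Polynomial.continuous_aeval Q).mul
        (Polynomial.continuous_aeval g).sqrt).continuousOn
    · intro x _ t ht
      have hmem : (Fin.snoc x t : Fin 1 → ℝ) ∈ r.domain := by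
        rw [hr]; exact ht
      show HasDerivAt (fun s : ℝ => aeval ((Fin.snoc x s : Fin 1 → ℝ) 0) Q *
        Real.sqrt (aeval ((Fin.snoc x s : Fin 1 → ℝ) 0) g)) (rb.integrand (Fin.snoc x t)) t
      rw [hrbi, indicator_of_mem hmem, hri hmem]
      simp only [hsnoc]
      exact exactForm_hasDerivAt_mul_sqrt g Q (hpos t ht)
    · intro x _
      simp only [hr₀i, Pi.zero_apply, hsnoc, hu, hv, Real.sqrt_zero, mul_zero, sub_zero]
  -- the band representation is a relation
  have hrb : KZ.of rb ∈ KZ.relations := by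
    have h1 := KZ.newtonLeibnizRel_subset_relations hNL
    have h2 : KZ.of r₀ ∈ KZ.relations :=
      KZ.of_mem_relations_of_eqOn_zero r₀ (by rw [hr₀i]; exact fun _ _ => rfl)
    simpa using KZ.relations.add_mem h1 h2
  -- ONE domain-additivity move: band versus oval, the two endpoints being null
  have hsub : E ⊆ rb.domain := by rw [hrbd]; exact subset_union_right
  have hre : KZ.of (rb.restrict E hE hsub) ∈ KZ.relations :=
    KZ.of_mem_relations_of_volume_eq_zero _ hEvol
  have hDA : KZ.of rb - KZ.of r - KZ.of (rb.restrict E hE hsub) ∈ KZ.domainAddRel :=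
    ⟨1, rb, r, rb.restrict E hE hsub, by rw [KZ.IntegralRep.domain_restrict, hrbd],
      measure_mono_null inter_subset_right hEvol,
      fun z hz => by rw [hrbi]; exact indicator_of_mem hz _, fun _ _ => rfl, rfl⟩
  have h2 : KZ.of r = KZ.of rb - (KZ.of rb - KZ.of r - KZ.of (rb.restrict E hE hsub)) -
      KZ.of (rb.restrict E hE hsub) := by abel
  rw [h2]
  exact KZ.relations.sub_mem (KZ.relations.sub_mem hrb (KZ.domainAddRel_subset_relations hDA)) hre

end Summit.KontsevichZagierPeriods.HermiteRigidity.RealEllipticSectorKernel
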